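import Summits.Ventures.QEC.Census.LRATLeaves
import Literature.InformationTheory.QuantumCodes.BBPinnedDistanceFlat
import HarnessLib

/-!
# Kernel-B certificates for bivariate-bicycle codes: the translation-pinned assembly `d_eq_of_kernelB_pinned`

Cell `qec`, PARTITION v2 row type-11 — the ASSEMBLY target of the `[[72,12,6]]` kernel-B (SAT/LRAT)
certificate in the director's preferred shape (pinned `enc-v2` leaves + 1 assembly; D10):
for a bivariate-bicycle code `C : BB.Code ℓ m` in FLAT indices (`C.HXFlat`, `C.HZFlat` on
`Fin (ℓm + ℓm)`, left block `0 … ℓm-1`, right block `ℓm …`; `BivariateBicycleCodes.lean`), type-12's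
translation-orbit lemma `BB.Code.d_eq_of_pinned_witness_flat` (`BBPinnedDistanceFlat.lean`) reduces
`C.d = d` to an explicit flat `Z`-logical of weight `d` plus «every flat `Z`-logical with bit `0` set, or
with the left block clear and bit `ℓm` set, has weight `≥ d`».  The two alternatives are exactly the two
CASES of qec-search-2's `enc-v2` certificate (`kb/cubes.py`): case 0 appends nothing before the cube
(whose first literal is the root `x₀`), case 1 appends `pinZeros ℓm = [¬x₀,…,¬x_{ℓm-1}]` before the cube
(whose first literal is `x_{ℓm}`) — the convention of the emitted leaf modules
(`Census/BB/BB72KBData.lean`: `leafCnf base pre cube`, `compCnf root cubes`).  The quoted hypothesis is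
discharged from: the leaf UNSATs (kernel/native replay), the two cube-coverage facts (`cover_of_unsat` on
the completeness CNFs `coverCNF 0 cubes₀`, `coverCNF ℓm cubes₁`), and completeness of the `X`-logical
basis (`hlog`, from rank certificates: `Census/LRATRank.lean`).  Results:
`BB.Code.le_hammingNorm_of_kernelB_pinned`, `BB.Code.d_eq_of_kernelB_pinned` / `dZ_eq_of_kernelB_pinned`,
and the route shape `BB.Code.le_hammingNorm_zLogical_of_kernelB_pinned` (`Mono ⊕ Mono` indexing — the body of
`BB72DistanceCertificate.NoZLogicalBelowSix` for `C = bb72`, `d = 6`).  The CNF data `rows`/`us` are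
literal lists tied to `C.HXFlat`/`LX` by `decide`d equations, so leaf modules never evaluate matrices.
-/

namespace Summit.Ventures.QEC.Census.LRATBridge

open Std.Sat Summit.Ventures.QEC.Census.CNFEncode
open Literature.InformationTheory.QuantumCodes Matrix

/-- Literals «bits `0 … N-1` clear»: `[¬x₀, …, ¬x_{N-1}]` — what case 1 of a two-block pinned certificate
appends before each cube (`BB72KBData.zerosL` for `N = 36`). -/
def pinZeros (N : ℕ) : List (Literal ℕ) := (List.range N).map fun i => (i, false)

/-- Literals of `pinZeros N` are coordinates (given `N ≤ n`). -/
theorem pinZeros_lt {N n : ℕ} (hN : N ≤ n) : ∀ l ∈ pinZeros N, l.1 < n := by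
  intro l hl
  simp only [pinZeros, List.mem_map, List.mem_range] at hl
  obtain ⟨i, hi, rfl⟩ := hl
  exact lt_of_lt_of_le hi hN

/-- A flat vector vanishing below `N` satisfies `pinZeros N`. -/
theorem satLits_pinZeros {n N : ℕ} (v : Fin n → ZMod 2) (hN : N ≤ n)
    (hzero : ∀ i : Fin n, (i : ℕ) < N → v i = 0) : SatLits (toAssign v) (pinZeros N) := by
  intro l hl
  simp only [pinZeros, List.mem_map, List.mem_range] at hl
  obtain ⟨i, hi, rfl⟩ := hl
  have hin : i < n := lt_of_lt_of_le hi hN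
  show toAssign v i = false
  simp only [toAssign, hin, ↓reduceDIte, hzero ⟨i, hin⟩ hi]
  simp

/-- A bit of `toAssign v` read back: `toAssign v i = true` when `v ⟨i, _⟩ ≠ 0`. -/
theorem toAssign_eq_true_of_ne {n : ℕ} (v : Fin n → ZMod 2) (i : Fin n) (h : v i ≠ 0) :
    toAssign v i = true := by
  rw [toAssign_val]; simpa using h

/-- **One leaf refutes one solution**: if `base ++ units (pre ++ q)` is UNSAT and the assignment of `v`
satisfies `pre` and `q` (coordinate literals), then `v` is not a solution of `Q_any`. -/
theorem not_solvesAny_of_leaf {n w : ℕ} {rows us : List (List ℕ)}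
    (hrows : ∀ r ∈ rows, ∀ i ∈ r, i < n) (hus : ∀ u ∈ us, ∀ i ∈ u, i < n)
    (pre q : List (Literal ℕ)) (hpre : ∀ l ∈ pre, l.1 < n) (hq : ∀ l ∈ q, l.1 < n)
    (hleaf : (leafCNF n rows us w pre q).Unsat) (a : ℕ → Bool) (ha : SatLits a pre) (haq : SatLits a q) :
    ¬ SolvesAny n rows us w a := by
  have hl : ∀ l ∈ pre ++ q, l.1 < n := fun l hl => by
    rcases List.mem_append.1 hl with hl | hl
    · exact hpre l hl
    · exact hq l hl
  have hs : SatLits a (pre ++ q) := fun l hl => by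
    rcases List.mem_append.1 hl with hl | hl
    · exact ha l hl
    · exact haq l hl
  exact cnfEncodeAny_append_unsat_imp (units (pre ++ q)) hrows hus (units_vars _ hl) hleaf a
    (units_eval _ _ hs)

end Summit.Ventures.QEC.Census.LRATBridge

namespace Literature.InformationTheory.QuantumCodes.BB.Code

open Matrix Std.Sat Summit.Ventures.QEC.Census.CNFEncode Summit.Ventures.QEC.Census.LRATBridge

variable {ℓ m : ℕ} [NeZero ℓ] [NeZero m] (C : Code ℓ m)

/-- **Kernel-B pinned lower bound for `QC(A,B)`** (dot-notation extension of the Literature structure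
`BB.Code`, declared from `Summits/`): every flat `Z`-logical `w` of `C` (`HXFlat w = 0`, `w ∉ rs HZFlat`)
in one of the two translation cases (bit `0` set; or left block clear and bit `ℓm` set) has weight
`≥ d`, given — with literal CNF data `rows` (row supports of `HXFlat`), `us` (supports of an `X`-logical
family `LX`) — (1) every leaf `leafCNF n rows us (d-1) [] q`, `q ∈ cubes₀`, and
`leafCNF n rows us (d-1) (pinZeros ℓm) q`, `q ∈ cubes₁`, is UNSAT; (2) the completeness CNFs
`coverCNF 0 cubes₀` and `coverCNF ℓm cubes₁` are UNSAT (the cubes of case `t` carry their root literal);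
(3) cube literals are coordinates; (4) `hlog`: every flat `Z`-logical meets some `LX_j` oddly. -/
theorem le_hammingNorm_of_kernelB_pinned {d k : ℕ} (LX : Fin k → Fin (ℓ * m + ℓ * m) → ZMod 2)
    (hlog : ∀ v : Fin (ℓ * m + ℓ * m) → ZMod 2, C.HXFlat *ᵥ v = 0 → v ∉ rowSpace C.HZFlat →
      ∃ j, LX j ⬝ᵥ v ≠ 0)
    (rows us : List (List ℕ)) (hrows : rowSupports C.HXFlat = rows) (hus : supports LX = us)
    (cubes₀ cubes₁ : List (List (Literal ℕ)))
    (hleaf₀ : ∀ q ∈ cubes₀, (leafCNF (ℓ * m + ℓ * m) rows us (d - 1) [] q).Unsat)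
    (hleaf₁ : ∀ q ∈ cubes₁, (leafCNF (ℓ * m + ℓ * m) rows us (d - 1) (pinZeros (ℓ * m)) q).Unsat)
    (hcover₀ : (coverCNF 0 cubes₀).Unsat) (hcover₁ : (coverCNF (ℓ * m) cubes₁).Unsat)
    (hlits₀ : ∀ q ∈ cubes₀, ∀ l ∈ q, l.1 < ℓ * m + ℓ * m)
    (hlits₁ : ∀ q ∈ cubes₁, ∀ l ∈ q, l.1 < ℓ * m + ℓ * m)
    (w : Fin (ℓ * m + ℓ * m) → ZMod 2) (hw : C.HXFlat *ᵥ w = 0) (hw' : w ∉ rowSpace C.HZFlat)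
    (hpin : w (qubitIndex (Sum.inl 0)) ≠ 0 ∨
      ((∀ i : Fin (ℓ * m + ℓ * m), (i : ℕ) < ℓ * m → w i = 0) ∧ w (qubitIndex (Sum.inr 0)) ≠ 0)) :
    d ≤ hammingNorm w := by
  subst hrows hus
  by_contra hlt
  have hsol : SolvesAny (ℓ * m + ℓ * m) (rowSupports C.HXFlat) (supports LX) (d - 1) (toAssign w) :=
    solvesAny_of_vector C.HXFlat LX w hw (hlog w hw hw') (by omega)
  have hr := rowSupports_lt C.HXFlat
  have hu := supports_lt LX
  rcases hpin with h0 | ⟨hzero, h1⟩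
  · -- case 0: bit 0 set
    have ha0 : toAssign w 0 = true := by
      have := toAssign_eq_true_of_ne w _ h0
      rwa [qubitIndex_inl_zero_val] at this
    obtain ⟨q, hq, hsat⟩ := cover_of_unsat hcover₀ (toAssign w) ha0
    exact not_solvesAny_of_leaf hr hu [] q (by simp) (hlits₀ q hq) (hleaf₀ q hq) (toAssign w)
      (fun _ h => by simp at h) hsat hsol
  · -- case 1: left block clear, bit ℓm set
    have ha1 : toAssign w (ℓ * m) = true := by
      have := toAssign_eq_true_of_ne w _ h1
      rwa [qubitIndex_inr_zero_val] at this
    obtain ⟨q, hq, hsat⟩ := cover_of_unsat hcover₁ (toAssign w) ha1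
    exact not_solvesAny_of_leaf hr hu (pinZeros (ℓ * m)) q (pinZeros_lt (by omega)) (hlits₁ q hq)
      (hleaf₁ q hq) (toAssign w) (satLits_pinZeros w (by omega) hzero) hsat hsol

/-- **`C.d = d` from a translation-pinned kernel-B certificate** (the `[[72,12,6]]` assembly shape):
an explicit flat `Z`-logical `u` of weight `d` (`hu`, `hu'`, `hwt`) together with the hypotheses of
`le_hammingNorm_of_kernelB_pinned` gives the distance of `QC(A,B)` via type-12's
`d_eq_of_pinned_witness_flat`. -/
theorem d_eq_of_kernelB_pinned {d k : ℕ} {u : Fin (ℓ * m + ℓ * m) → ZMod 2}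
    (hu : C.HXFlat *ᵥ u = 0) (hu' : u ∉ rowSpace C.HZFlat) (hwt : hammingNorm u = d)
    (LX : Fin k → Fin (ℓ * m + ℓ * m) → ZMod 2)
    (hlog : ∀ v : Fin (ℓ * m + ℓ * m) → ZMod 2, C.HXFlat *ᵥ v = 0 → v ∉ rowSpace C.HZFlat →
      ∃ j, LX j ⬝ᵥ v ≠ 0)
    (rows us : List (List ℕ)) (hrows : rowSupports C.HXFlat = rows) (hus : supports LX = us)
    (cubes₀ cubes₁ : List (List (Literal ℕ)))
    (hleaf₀ : ∀ q ∈ cubes₀, (leafCNF (ℓ * m + ℓ * m) rows us (d - 1) [] q).Unsat)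
    (hleaf₁ : ∀ q ∈ cubes₁, (leafCNF (ℓ * m + ℓ * m) rows us (d - 1) (pinZeros (ℓ * m)) q).Unsat)
    (hcover₀ : (coverCNF 0 cubes₀).Unsat) (hcover₁ : (coverCNF (ℓ * m) cubes₁).Unsat)
    (hlits₀ : ∀ q ∈ cubes₀, ∀ l ∈ q, l.1 < ℓ * m + ℓ * m)
    (hlits₁ : ∀ q ∈ cubes₁, ∀ l ∈ q, l.1 < ℓ * m + ℓ * m) : C.d = d :=
  C.d_eq_of_pinned_witness_flat hu hu' hwt fun w hw hw' hpin =>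
    C.le_hammingNorm_of_kernelB_pinned LX hlog rows us hrows hus cubes₀ cubes₁ hleaf₀ hleaf₁ hcover₀
      hcover₁ hlits₀ hlits₁ w hw hw' hpin

/-- The same certificate gives `dZ` of the flat CSS code `C.cssFlat` and of `C.css`. -/
theorem dZ_eq_of_kernelB_pinned {d k : ℕ} {u : Fin (ℓ * m + ℓ * m) → ZMod 2}
    (hu : C.HXFlat *ᵥ u = 0) (hu' : u ∉ rowSpace C.HZFlat) (hwt : hammingNorm u = d)
    (LX : Fin k → Fin (ℓ * m + ℓ * m) → ZMod 2)
    (hlog : ∀ v : Fin (ℓ * m + ℓ * m) → ZMod 2, C.HXFlat *ᵥ v = 0 → v ∉ rowSpace C.HZFlat →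
      ∃ j, LX j ⬝ᵥ v ≠ 0)
    (rows us : List (List ℕ)) (hrows : rowSupports C.HXFlat = rows) (hus : supports LX = us)
    (cubes₀ cubes₁ : List (List (Literal ℕ)))
    (hleaf₀ : ∀ q ∈ cubes₀, (leafCNF (ℓ * m + ℓ * m) rows us (d - 1) [] q).Unsat)
    (hleaf₁ : ∀ q ∈ cubes₁, (leafCNF (ℓ * m + ℓ * m) rows us (d - 1) (pinZeros (ℓ * m)) q).Unsat)
    (hcover₀ : (coverCNF 0 cubes₀).Unsat) (hcover₁ : (coverCNF (ℓ * m) cubes₁).Unsat)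
    (hlits₀ : ∀ q ∈ cubes₀, ∀ l ∈ q, l.1 < ℓ * m + ℓ * m)
    (hlits₁ : ∀ q ∈ cubes₁, ∀ l ∈ q, l.1 < ℓ * m + ℓ * m) :
    C.cssFlat.dZ = d ∧ C.css.dZ = d :=
  C.cssFlat_dZ_eq_of_pinned_witness_flat hu hu' hwt fun w hw hw' hpin =>
    C.le_hammingNorm_of_kernelB_pinned LX hlog rows us hrows hus cubes₀ cubes₁ hleaf₀ hleaf₁ hcover₀
      hcover₁ hlits₀ hlits₁ w hw hw' hpin

/-- **Route shape** (`BB72DistanceCertificate.NoZLogicalBelowSix` is this with `C = bb72`, `d = 6`):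
every `Z`-logical of `C.css` — in the paper's `ℤ_ℓ × ℤ_m ⊕ ℤ_ℓ × ℤ_m` indexing — has weight `≥ d`,
from the pinned kernel-B certificate data of `le_hammingNorm_of_kernelB_pinned` (type-12's
`exists_zLogicalFlat_pinned` supplies the pin; flat ↔ `Mono ⊕ Mono` transport by
`HXFlat_mulVec_eq_zero_iff` / `mem_rowSpace_HZFlat_iff` / `hammingNorm_comp_equiv`). -/
theorem le_hammingNorm_zLogical_of_kernelB_pinned {d k : ℕ}
    (LX : Fin k → Fin (ℓ * m + ℓ * m) → ZMod 2)
    (hlog : ∀ v : Fin (ℓ * m + ℓ * m) → ZMod 2, C.HXFlat *ᵥ v = 0 → v ∉ rowSpace C.HZFlat →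
      ∃ j, LX j ⬝ᵥ v ≠ 0)
    (rows us : List (List ℕ)) (hrows : rowSupports C.HXFlat = rows) (hus : supports LX = us)
    (cubes₀ cubes₁ : List (List (Literal ℕ)))
    (hleaf₀ : ∀ q ∈ cubes₀, (leafCNF (ℓ * m + ℓ * m) rows us (d - 1) [] q).Unsat)
    (hleaf₁ : ∀ q ∈ cubes₁, (leafCNF (ℓ * m + ℓ * m) rows us (d - 1) (pinZeros (ℓ * m)) q).Unsat)
    (hcover₀ : (coverCNF 0 cubes₀).Unsat) (hcover₁ : (coverCNF (ℓ * m) cubes₁).Unsat)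
    (hlits₀ : ∀ q ∈ cubes₀, ∀ l ∈ q, l.1 < ℓ * m + ℓ * m)
    (hlits₁ : ∀ q ∈ cubes₁, ∀ l ∈ q, l.1 < ℓ * m + ℓ * m)
    (v : Mono ℓ m ⊕ Mono ℓ m → ZMod 2) (hv : C.css.HX *ᵥ v = 0) (hv' : v ∉ C.css.rowSpZ) :
    d ≤ hammingNorm v := by
  have hcomp : (v ∘ qubitIndex.symm) ∘ (qubitIndex (ℓ := ℓ) (m := m)) = v := by funext q; simp
  have hu : C.HXFlat *ᵥ (v ∘ qubitIndex.symm) = 0 :=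
    (C.HXFlat_mulVec_eq_zero_iff _).2 (by rw [hcomp]; exact hv)
  have hu' : v ∘ qubitIndex.symm ∉ rowSpace C.HZFlat := fun h => by
    have h' := (C.mem_rowSpace_HZFlat_iff _).1 h
    rw [hcomp] at h'
    exact hv' h'
  obtain ⟨u', h₁, h₂, hwt, hpin⟩ := C.exists_zLogicalFlat_pinned hu hu'
  have h := C.le_hammingNorm_of_kernelB_pinned LX hlog rows us hrows hus cubes₀ cubes₁ hleaf₀ hleaf₁
    hcover₀ hcover₁ hlits₀ hlits₁ u' h₁ h₂ hpin
  rw [hwt, BB.hammingNorm_comp_equiv v qubitIndex.symm] at h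
  exact h

end Literature.InformationTheory.QuantumCodes.BB.Code
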